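import Summits.CriticalPhenomena.PercolationContinuityZ3.Theorems.PercNearOneGluingNoHeavyQuantSubfloorHubLaws
import Summits.CriticalPhenomena.PercolationContinuityZ3.Theorems.PercNearOneGluingNoHeavyQuantNearRouteCertificate
import HarnessLib

/-!
# QUANT lane R8, T-DEC: THE SUB-FLOOR HUB OF EVERY WIDTH IS SDEC — `C-hub_j = C(γ₁) ∗ … ∗ C(γ_j)` (`j` far-giant pieces `C(γ) = {1: 1−γ, 3: γ}`,
# `1/2 ≤ γᵢ < 1`, `3x ≤ 1 + 2γᵢ`) is SDEC for EVERY `j ≥ 2` (census-1 gen 31; the k-general core of every forest of glued children / 3-chains)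

builds on p205010 (kernel theorem, internal audit signed; external expert review pending)

Support file (`--supports stmt-CriticalPhenomena-4575`), QUANT lane seat prim-quant-census-1 (gen 31); memo
`run/shared/lean/prim/quant/prim-quant-census-1/g31/HUB-GENERAL-G31.md`.  Theorems only (no definitions), standard axioms, no sorries.  Uses part 1
(`…QuantSubfloorHubLaws`: `cHub`, `cHub_laws`, `cHub_struct`), the progression criterion `sdec_progression` (census-1 g31 `…QuantNearRouteCertificate`),
and the widths 2 and 3 of census-1 g30 (`sdec_pairHub`, `sdec_tripleHub`, `pairHub_blob_ineq`, `pairHub_eq_lconv`, `tripleHub_eq_lconv`).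

THE PROOF (k-general; no case analysis in `j` beyond `j ∈ {2, 3}` / `j ≥ 4`).
* `choose_ge_of_between` — unimodality `C(j, s+1) ≤ C(j, m)` for `s + 1 ≤ m ≤ j − s − 1` (`Nat.choose_le_succ_of_lt_half_left`, `Nat.choose_symm`).
* `cHub_chain` — from the dominance steps `o(j − i)u_i ≤ (i + 1)u_{i+1}` (`o ≥ 1`): `C(j,s)·u_m ≥ o·C(j,m)·u_s` for `s < m ≤ j`.
* **`cHub_routeBound`** — the ROUTE BOUND of the progression criterion: for `j ≥ 4`, every charged `l` with `2l < 3j` and every `r ≥ 1` with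
  `4(r−1) < 3(3j − 2l)`: `2o·u(l) ≤ u(l + 2r)` (then `l = j + 2s`, `4s < j`, `s + 1 ≤ s + r ≤ j − s − 1`, `j ≥ 3s + 2`, so
  `u_{s+r} ≥ o·C(j,s+r)/C(j,s)·u_s ≥ o·C(j,s+1)/C(j,s)·u_s ≥ 2o·u_s`).
* **`sdec_cHub`** — for every list `P` with `2 ≤ |P|`, `1/2 ≤ γ < 1` and `3x ≤ 1 + 2γ` (`γ ∈ P`), `0 < x`: **`SDEC x (3|P|) (cHub P)`**.
  Widths 2, 3: g30.  Width `≥ 4`: `sdec_progression` with `R = 2o`, `o = max(1, x/(2(1−x)))`: `o(1−γ) ≤ γ` is g30's `pairHub_blob_ineq`,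
  `x(1 + 2o) ≤ 2o` is `x/(1−x) ≤ 2o`, mean `< 3j` and `x·3j ≤` mean termwise (`farPieces_sum_bounds`).
EXACT CENSUS (memo §1; code `quant/prim-quant-census-1/g31/code/exp4.py`): the five claims of the certificate on 883 000 (hub, gate) instances,
`j = 4..9` incl. the near-sure corner, 0 failures; SDEC itself by the kernel-faithful per-layer LP for `j ≤ 6` (1 127 hubs × 16 gates × all layers).

HONEST STATUS.  `SiblingStep`, `GluedDominated`, `SDECConvClosed`, `FarTreeRow` OPEN; RATE class (log\*) / honest sentence of
`run/shared/lean/prim/quant/README.md` unchanged.  [this work].  Unimodality of binomial coefficients is classical; nothing here is cited as a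
published result.  The gluing rows served [cite: KozmaNitzan2024, Conjecture 3 (p. 15)]; product measure [cite: Grimmett1999, §1.3 p. 10].
-/

noncomputable section

open scoped BigOperators

namespace Summit.CriticalPhenomena.PercolationContinuityZ3.Theorems
namespace Quant
namespace LawDec

open Finset

/-- the FAR-GIANT PIECE `C(γ) = {1, 3; γ}`: one sure relay over an under-floor 2-blob at gate `γ` -/
local notation3 "CP[" a "]" => (fun h : ℕ => (1 - (a : ℝ)) * (if h = 1 then (1 : ℝ) else 0) + (a : ℝ) * (if h = 3 then (1 : ℝ) else 0))

/-- the PAIR HUB (as in `…QuantSubfloorPairHub`) -/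
local notation3 "PH[" a ", " b "]" => (fun h : ℕ =>
  (1 - (a : ℝ)) * (1 - (b : ℝ)) * (if h = 2 then (1 : ℝ) else 0) +
  ((a : ℝ) * (1 - (b : ℝ)) + (1 - (a : ℝ)) * (b : ℝ)) * (if h = 4 then (1 : ℝ) else 0) +
  (a : ℝ) * (b : ℝ) * (if h = 6 then (1 : ℝ) else 0))

/-- the TRIPLE HUB (as in `…QuantSubfloorTripleHub`) -/
local notation3 "TH[" a ", " b ", " c "]" => (fun h : ℕ =>
  (1 - (a : ℝ)) * (1 - (b : ℝ)) * (1 - (c : ℝ)) * (if h = 3 then (1 : ℝ) else 0) +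
  ((a : ℝ) * (1 - (b : ℝ)) * (1 - (c : ℝ)) + (1 - (a : ℝ)) * (b : ℝ) * (1 - (c : ℝ)) + (1 - (a : ℝ)) * (1 - (b : ℝ)) * (c : ℝ)) *
    (if h = 5 then (1 : ℝ) else 0) +
  ((a : ℝ) * (b : ℝ) * (1 - (c : ℝ)) + (a : ℝ) * (1 - (b : ℝ)) * (c : ℝ) + (1 - (a : ℝ)) * (b : ℝ) * (c : ℝ)) *
    (if h = 7 then (1 : ℝ) else 0) +
  (a : ℝ) * (b : ℝ) * (c : ℝ) * (if h = 9 then (1 : ℝ) else 0))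

/-! ### From likelihood-ratio dominance to the route bound -/

/-- unimodality of the binomial coefficients: `C(n, s+1) ≤ C(n, m)` for `s + 1 ≤ m ≤ n − s − 1`. [this work] -/
theorem choose_ge_of_between (n s m : ℕ) (h1 : s + 1 ≤ m) (h2 : m + s + 1 ≤ n) : n.choose (s + 1) ≤ n.choose m := by
  -- below the middle: monotone
  have up : ∀ d : ℕ, s + 1 + d ≤ n / 2 → n.choose (s + 1) ≤ n.choose (s + 1 + d) := by
    intro d
    induction d with
    | zero => intro _; simp
    | succ d ih =>
      intro hd
      calc n.choose (s + 1) ≤ n.choose (s + 1 + d) := ih (by omega)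
        _ ≤ n.choose (s + 1 + d + 1) := Nat.choose_le_succ_of_lt_half_left (by omega)
        _ = n.choose (s + 1 + (d + 1)) := by rw [Nat.add_assoc]
  by_cases hm : m ≤ n / 2
  · have := up (m - (s + 1)) (by omega)
    rwa [show s + 1 + (m - (s + 1)) = m by omega] at this
  · -- above the middle: symmetry
    have hmn : m ≤ n := by omega
    have e : n.choose m = n.choose (n - m) := (Nat.choose_symm hmn).symm
    rw [e]
    have := up (n - m - (s + 1)) (by omega)
    rwa [show s + 1 + (n - m - (s + 1)) = n - m by omega] at this

/-- **the chain**: from the dominance steps, `C(j,s)·u_m ≥ o·C(j,m)·u_s` for `s < m ≤ j` (`o ≥ 1`, `u ≥ 0`). [this work] -/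
theorem cHub_chain (o : ℝ) (ho1 : 1 ≤ o) (j : ℕ) (u : ℕ → ℝ) (hu0 : ∀ h, 0 ≤ u h)
    (hlr : ∀ i : ℕ, o * ((j : ℝ) - i) * u (j + 2 * i) ≤ ((i : ℝ) + 1) * u (j + 2 * (i + 1))) (s : ℕ) :
    ∀ m : ℕ, s + 1 ≤ m → m ≤ j → o * (j.choose m : ℝ) * u (j + 2 * s) ≤ (j.choose s : ℝ) * u (j + 2 * m) := by
  refine Nat.le_induction ?_ ?_
  · intro hsj
    have h := hlr s
    have e := Nat.choose_succ_right_eq j s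
    have e' : ((j.choose (s + 1) : ℕ) : ℝ) * ((s : ℝ) + 1) = (j.choose s : ℝ) * ((j : ℝ) - s) := by
      have : ((j.choose (s + 1) * (s + 1) : ℕ) : ℝ) = ((j.choose s * (j - s) : ℕ) : ℝ) := by rw [e]
      push_cast at this
      rw [Nat.cast_sub (by omega)] at this
      exact this
    have hs0 : (0 : ℝ) < (s : ℝ) + 1 := by positivity
    -- multiply the step by `C(j,s)` and use `e'`
    have h2 := mul_le_mul_of_nonneg_left h (Nat.cast_nonneg (j.choose s))
    have : ((s : ℝ) + 1) * (o * (j.choose (s + 1) : ℝ) * u (j + 2 * s)) ≤ ((s : ℝ) + 1) * ((j.choose s : ℝ) * u (j + 2 * (s + 1))) :=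
      calc ((s : ℝ) + 1) * (o * (j.choose (s + 1) : ℝ) * u (j + 2 * s))
          = o * u (j + 2 * s) * ((j.choose (s + 1) : ℝ) * ((s : ℝ) + 1)) := by ring
        _ = o * u (j + 2 * s) * ((j.choose s : ℝ) * ((j : ℝ) - s)) := by rw [e']
        _ = (j.choose s : ℝ) * (o * ((j : ℝ) - s) * u (j + 2 * s)) := by ring
        _ ≤ (j.choose s : ℝ) * (((s : ℝ) + 1) * u (j + 2 * (s + 1))) := h2
        _ = ((s : ℝ) + 1) * ((j.choose s : ℝ) * u (j + 2 * (s + 1))) := by ring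
    exact le_of_mul_le_mul_left this hs0
  · intro m hsm ih hmj
    have ih' := ih (by omega)
    have h := hlr m
    have e := Nat.choose_succ_right_eq j m
    have e' : ((j.choose (m + 1) : ℕ) : ℝ) * ((m : ℝ) + 1) = (j.choose m : ℝ) * ((j : ℝ) - m) := by
      have : ((j.choose (m + 1) * (m + 1) : ℕ) : ℝ) = ((j.choose m * (j - m) : ℕ) : ℝ) := by rw [e]
      push_cast at this
      rw [Nat.cast_sub (by omega)] at this
      exact this
    have hm0 : (0 : ℝ) < (m : ℝ) + 1 := by positivity
    have hjm : (0 : ℝ) ≤ (j : ℝ) - m := by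
      have : (m : ℝ) ≤ j := by exact_mod_cast (by omega : m ≤ j)
      linarith
    have hcs : (0 : ℝ) ≤ (j.choose s : ℝ) := Nat.cast_nonneg _
    have hcm : (0 : ℝ) ≤ (j.choose m : ℝ) := Nat.cast_nonneg _
    -- `C(j,s)(m+1)u_{m+1} ≥ o(j−m)C(j,s)u_m ≥ o(j−m)·o·C(j,m)u_s ≥ o(j−m)C(j,m)u_s = o(m+1)C(j,m+1)u_s`
    have ho0 : (0 : ℝ) ≤ o * ((j : ℝ) - m) := mul_nonneg (by linarith) hjm
    have h2 := mul_le_mul_of_nonneg_left h hcs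
    have h3 := mul_le_mul_of_nonneg_left ih' ho0
    have h4 : (j.choose m : ℝ) * u (j + 2 * s) ≤ o * (j.choose m : ℝ) * u (j + 2 * s) := by
      have := mul_nonneg (show (0 : ℝ) ≤ o - 1 by linarith) (mul_nonneg hcm (hu0 (j + 2 * s)))
      nlinarith
    have h4' := mul_le_mul_of_nonneg_left h4 ho0
    have : ((m : ℝ) + 1) * (o * (j.choose (m + 1) : ℝ) * u (j + 2 * s)) ≤ ((m : ℝ) + 1) * ((j.choose s : ℝ) * u (j + 2 * (m + 1))) :=
      calc ((m : ℝ) + 1) * (o * (j.choose (m + 1) : ℝ) * u (j + 2 * s))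
          = o * u (j + 2 * s) * ((j.choose (m + 1) : ℝ) * ((m : ℝ) + 1)) := by ring
        _ = o * u (j + 2 * s) * ((j.choose m : ℝ) * ((j : ℝ) - m)) := by rw [e']
        _ = o * ((j : ℝ) - m) * ((j.choose m : ℝ) * u (j + 2 * s)) := by ring
        _ ≤ o * ((j : ℝ) - m) * (o * (j.choose m : ℝ) * u (j + 2 * s)) := h4'
        _ ≤ o * ((j : ℝ) - m) * ((j.choose s : ℝ) * u (j + 2 * m)) := h3
        _ = (j.choose s : ℝ) * (o * ((j : ℝ) - m) * u (j + 2 * m)) := by ring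
        _ ≤ (j.choose s : ℝ) * (((m : ℝ) + 1) * u (j + 2 * (m + 1))) := h2
        _ = ((m : ℝ) + 1) * ((j.choose s : ℝ) * u (j + 2 * (m + 1))) := by ring
    exact le_of_mul_le_mul_left this hm0

/-- **THE ROUTE BOUND of the progression criterion for the hub** (`|P| = j ≥ 4`, `1 ≤ o ≤` every odds): for every charged `l` with `2l < 3j` and every
`r ≥ 1` with `4(r − 1) < 3(3j − 2l)`: `2o·u(l) ≤ u(l + 2r)`. [this work] -/
theorem cHub_routeBound (o : ℝ) (ho1 : 1 ≤ o) (P : List ℝ) (hP : ∀ γ ∈ P, 0 ≤ γ ∧ γ ≤ 1 ∧ o * (1 - γ) ≤ γ) (hj : 4 ≤ P.length)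
    (l r : ℕ) (hl : cHub P l ≠ 0) (h2l : 2 * l < 3 * P.length) (hr : 1 ≤ r) (h4 : 4 * (r - 1) < 3 * (3 * P.length - 2 * l)) :
    2 * o * cHub P l ≤ cHub P (l + 2 * r) := by
  obtain ⟨hsupp, hlr⟩ := cHub_struct o (by linarith) P hP
  obtain ⟨a0, _, _, _⟩ := cHub_laws P (fun γ' h' => ⟨(hP γ' h').1, (hP γ' h').2.1⟩)
  set j : ℕ := P.length with hj'
  obtain ⟨s, rfl, hsj⟩ := hsupp l hl
  have h4s : 4 * s < j := by omega
  have hsr : s + r + s + 1 ≤ j := by omega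
  have h3s : 3 * s + 2 ≤ j := by omega
  -- dominance steps in `s`-indexing
  have hlr' : ∀ i : ℕ, o * ((j : ℝ) - i) * cHub P (j + 2 * i) ≤ ((i : ℝ) + 1) * cHub P (j + 2 * (i + 1)) := by
    intro i
    have := hlr (j + 2 * i)
    push_cast at this
    have e1 : o * (3 * (j : ℝ) - ((j : ℝ) + 2 * i)) = 2 * (o * ((j : ℝ) - i)) := by ring
    have e2 : ((j : ℝ) + 2 * i + 2 - j) = 2 * ((i : ℝ) + 1) := by ring
    rw [e1, e2, show j + 2 * i + 2 = j + 2 * (i + 1) by ring] at this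
    linarith
  have chain := cHub_chain o ho1 j (cHub P) a0 hlr' s (s + r) (by omega) (by omega)
  -- `C(j, s+r) ≥ C(j, s+1) ≥ 2·C(j, s)`
  have hc1 : j.choose (s + 1) ≤ j.choose (s + r) := choose_ge_of_between j s (s + r) (by omega) (by omega)
  have hc2 : 2 * j.choose s ≤ j.choose (s + 1) := by
    have e := Nat.choose_succ_right_eq j s
    have hss : 2 * (s + 1) ≤ j - s := by omega
    have h1 : (2 * j.choose s) * (s + 1) ≤ j.choose (s + 1) * (s + 1) := by
      rw [e, Nat.mul_comm 2, Nat.mul_assoc]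
      exact Nat.mul_le_mul_left _ hss
    exact Nat.le_of_mul_le_mul_right h1 (Nat.succ_pos s)
  have hc : (2 : ℝ) * (j.choose s : ℝ) ≤ (j.choose (s + r) : ℝ) := by exact_mod_cast hc2.trans hc1
  have hcs : (0 : ℝ) < (j.choose s : ℝ) := by exact_mod_cast Nat.choose_pos (by omega)
  rw [show j + 2 * s + 2 * r = j + 2 * (s + r) by ring]
  have hus := a0 (j + 2 * s)
  -- `C(j,s)·u_{s+r} ≥ o·C(j,s+r)·u_s ≥ 2o·C(j,s)·u_s`
  have ho0 : 0 ≤ o * cHub P (j + 2 * s) := mul_nonneg (by linarith) hus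
  have : (j.choose s : ℝ) * (2 * o * cHub P (j + 2 * s)) ≤ (j.choose s : ℝ) * cHub P (j + 2 * (s + r)) :=
    calc (j.choose s : ℝ) * (2 * o * cHub P (j + 2 * s)) = (2 * (j.choose s : ℝ)) * (o * cHub P (j + 2 * s)) := by ring
      _ ≤ (j.choose (s + r) : ℝ) * (o * cHub P (j + 2 * s)) := mul_le_mul_of_nonneg_right hc ho0
      _ = o * (j.choose (s + r) : ℝ) * cHub P (j + 2 * s) := by ring
      _ ≤ (j.choose s : ℝ) * cHub P (j + 2 * (s + r)) := chain
  exact le_of_mul_le_mul_left this hcs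

/-! ### The hub of every width is SDEC -/

/-- sums over the list: lower and upper bounds termwise. [this work] -/
theorem farPieces_sum_bounds (x : ℝ) : ∀ P : List ℝ, (∀ γ ∈ P, γ < 1 ∧ 3 * x ≤ 1 + 2 * γ) →
    3 * x * (P.length : ℝ) ≤ (P.map (fun γ => 1 + 2 * γ)).sum ∧
      (P ≠ [] → (P.map (fun γ => 1 + 2 * γ)).sum < 3 * (P.length : ℝ))
  | [], _ => by simp
  | γ :: P, hP => by
    have hγ := hP γ (by simp)
    have ih := farPieces_sum_bounds x P (fun γ' h' => hP γ' (List.mem_cons_of_mem γ h'))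
    simp only [List.map_cons, List.sum_cons, List.length_cons, Nat.cast_succ]
    refine ⟨by linarith [ih.1], fun _ => ?_⟩
    rcases eq_or_ne P [] with hn | hn
    · subst hn; simp; linarith [hγ.1]
    · have := ih.2 hn; linarith [hγ.1]

/-- **THE SUB-FLOOR HUB OF EVERY WIDTH IS SDEC.**  For every list `P` of `j ≥ 2` gates with `1/2 ≤ γ < 1` and `3x ≤ 1 + 2γ` (`γ ∈ P`), and every
floor `0 < x`: `SDEC x (3j) (cHub P)`.  Widths 2, 3: census-1 g30; width `≥ 4`: the progression criterion with `R = 2·max(1, x/(2(1−x)))`. [this work] -/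
theorem sdec_cHub {x : ℝ} (hx0 : 0 < x) : ∀ P : List ℝ, 2 ≤ P.length → (∀ γ ∈ P, 1 / 2 ≤ γ ∧ γ < 1 ∧ 3 * x ≤ 1 + 2 * γ) →
    SDEC x (3 * P.length) (cHub P) := by
  intro P hP2 hP
  have hx1 : x < 1 := by
    obtain ⟨γ, hγ⟩ := List.exists_mem_of_ne_nil P (by rintro rfl; simp at hP2)
    have := hP γ hγ; linarith [this.2.1, this.2.2]
  have cpv : ∀ γ : ℝ, ∀ h, 3 < h → CP[γ] h = 0 := fun γ h hh => by
    simp only [show h ≠ 1 by omega, show h ≠ 3 by omega, if_false, mul_zero, add_zero]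
  rcases P with _ | ⟨γ₁, _ | ⟨γ₂, _ | ⟨γ₃, _ | ⟨γ₄, P⟩⟩⟩⟩
  · simp at hP2
  · simp at hP2
  · -- width 2: the pair hub
    have h1 := hP γ₁ (by simp); have h2 := hP γ₂ (by simp)
    have e0 : cHub [γ₂] = CP[γ₂] := funext fun h => lconv_delta_left 0 3 _ (cpv γ₂) h
    have e : cHub [γ₁, γ₂] = PH[γ₂, γ₁] := by
      show lconv (3 * 1) 3 (cHub [γ₂]) CP[γ₁] = _
      rw [e0]; exact pairHub_eq_lconv γ₂ γ₁
    show SDEC x 6 (cHub [γ₁, γ₂])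
    rw [e]
    exact sdec_pairHub hx0 hx1 h2.1 h2.2.1 h1.1 h1.2.1 h2.2.2 h1.2.2
  · -- width 3: the triple hub
    have h1 := hP γ₁ (by simp); have h2 := hP γ₂ (by simp); have h3 := hP γ₃ (by simp)
    have e0 : cHub [γ₃] = CP[γ₃] := funext fun h => lconv_delta_left 0 3 _ (cpv γ₃) h
    have e1 : cHub [γ₂, γ₃] = PH[γ₃, γ₂] := by
      show lconv (3 * 1) 3 (cHub [γ₃]) CP[γ₂] = _
      rw [e0]; exact pairHub_eq_lconv γ₃ γ₂
    have e : cHub [γ₁, γ₂, γ₃] = TH[γ₃, γ₂, γ₁] := by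
      show lconv (3 * 2) 3 (cHub [γ₂, γ₃]) CP[γ₁] = _
      rw [e1]; exact tripleHub_eq_lconv γ₃ γ₂ γ₁
    show SDEC x 9 (cHub [γ₁, γ₂, γ₃])
    rw [e]
    exact sdec_tripleHub hx0 hx1 h3.1 h3.2.1 h2.1 h2.2.1 h1.1 h1.2.1 h3.2.2 h2.2.2 h1.2.2
  · -- width ≥ 4: the progression criterion
    set Q : List ℝ := γ₁ :: γ₂ :: γ₃ :: γ₄ :: P with hQ
    have hj : 4 ≤ Q.length := by simp [hQ]
    set j : ℕ := Q.length with hjQ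
    have hP01 : ∀ γ ∈ Q, 0 ≤ γ ∧ γ ≤ 1 := fun γ h => ⟨by linarith [(hP γ h).1], (hP γ h).2.1.le⟩
    obtain ⟨a0, aM, a1, am⟩ := cHub_laws Q hP01
    set T₀ : ℝ := (Q.map (fun γ => 1 + 2 * γ)).sum with hT₀
    obtain ⟨hlo, hhi⟩ := farPieces_sum_bounds x Q (fun γ h => ⟨(hP γ h).2.1, (hP γ h).2.2⟩)
    have hT3 : T₀ < 3 * (j : ℝ) := hhi (by simp [hQ])
    have hj4 : (4 : ℝ) ≤ j := by exact_mod_cast hj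
    have hT0 : 0 < T₀ := by nlinarith
    -- the constant `o = max(1, x/(2(1−x)))`
    set o : ℝ := max 1 (x / (2 * (1 - x))) with ho
    have ho1 : 1 ≤ o := le_max_left _ _
    have hodds : ∀ γ ∈ Q, 0 ≤ γ ∧ γ ≤ 1 ∧ o * (1 - γ) ≤ γ := by
      intro γ h
      obtain ⟨g1, g2, g3⟩ := hP γ h
      refine ⟨by linarith, g2.le, ?_⟩
      rw [ho, max_mul_of_nonneg _ _ (by linarith : (0 : ℝ) ≤ 1 - γ)]
      refine max_le (by linarith) ?_
      have key := pairHub_blob_ineq g1 g2.le g3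
      rw [div_mul_eq_mul_div, div_le_iff₀ (by linarith)]
      linarith
    have hxR : x * (1 + 2 * o) ≤ 2 * o := by
      have : x / (2 * (1 - x)) ≤ o := le_max_right _ _
      rw [div_le_iff₀ (by linarith)] at this
      nlinarith
    obtain ⟨hsupp, _⟩ := cHub_struct o (by linarith) Q hodds
    refine sdec_progression x T₀ (2 * o) j (cHub Q) hj hx0 hx1 a0 aM a1 am hT0 hT3 (by push_cast; linarith) ?_ (by linarith) hxR ?_
    · intro h hh
      by_contra hne
      obtain ⟨s, hs, _⟩ := hsupp h hne
      omega
    · intro l r _ hlT hμl hr h4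
      have h2l : 2 * l < 3 * j := by
        have : (2 : ℝ) * l < 3 * j := by linarith
        exact_mod_cast this
      have h4' : 4 * (r - 1) < 3 * (3 * j - 2 * l) := by
        have e1 : ((3 * j - 2 * l : ℕ) : ℝ) = 3 * (j : ℝ) - 2 * l := by
          rw [Nat.cast_sub h2l.le]; push_cast; ring
        have e2 : ((r - 1 : ℕ) : ℝ) = (r : ℝ) - 1 := by rw [Nat.cast_sub hr]; simp
        have : (4 : ℝ) * ((r - 1 : ℕ) : ℝ) < 3 * ((3 * j - 2 * l : ℕ) : ℝ) := by rw [e1, e2]; linarith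
        exact_mod_cast this
      have := cHub_routeBound o ho1 Q hodds hj l r hμl.ne' h2l hr h4'
      linarith

end LawDec
end Quant
end Summit.CriticalPhenomena.PercolationContinuityZ3.Theorems
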